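import Literature.NumberTheory.LFunctions.KloostermanIncompleteSplit
import Literature.NumberTheory.LFunctions.KloostermanFractionsOffDiagSet
import HarnessLib

/-!
# Trilinear forms with Kloosterman fractions: the sharp incomplete Kloosterman bound with a twist

Topic `NumberTheory/LFunctions`.  S. Bettin, V. Chandee, *Trilinear forms with Kloosterman
fractions*, Adv. Math. 328 (2018), Appendix, Lemma 1 (kseq):
"`∑_{x ∈ I, (x,γδ)=1} e(α x̄/γ) ≪ (γδ)^ε (h₁/h) (γ₁/(α,γ₁))^{1/2} + (α,γ₁) X δ^ε/(γ₁ k)`" — the gcd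
`(α, γ₁)` IMPROVES the completed-sum term (proof: "we can assume `h = 1` and similarly also that
`(α, γ) = 1`", then Erdős–Turán + Weil).  The tree's `KI_sum_progression_le`
(`KloostermanIncompleteInterval.lean`) is the weaker form with `√s √(a,s)`; the §3 bookkeeping of the
source ((3.3): "`≪ (bLN)^{1/2+ε} + (a₁ℓ₁ − a₂ℓ₂, bn₁ℓ₁) M^{1+ε}/(bLN)`") needs the sharp form.
This file PROVES it (case `k = 1`, `h = 1`), by the reduction `α → α/(α,γ)`, `γ → γ/(α,γ)` of the
phase and `KI_sum_progression_coprime_le` (which keeps the condition `(x, γ) = 1`), together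
with the partial summation against the twist `e(θ/x)` of Remark 2:

* `BC_twisted_abel_le` — Abel summation against `e(θ/n)` for ANY summand with bounded partial
  sums (`kfw_abel_bound`, `kfw_twist_variation`);
* `BC_kphase_gcd_reduce` — `e(α x̄^{(γ)}/γ) = e((α/g) x̄^{(γ/g)}/(γ/g))`, `g = (α, γ)`, `(x, γ) = 1`;
* **`BC_msum_sharp_le`**, **`BC_twisted_msum_sharp_le`** — for `γ ≥ 1`, `α ∈ ℤ`, `g = (α,γ)`,
  `γ' = γ/g`, integers `0 ≤ M₁ ≤ M₂`, real `θ`: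
  `‖∑_{M₁<x≤M₂,(x,γ)=1} e(α x̄/γ) e(θ/x)‖ ≤ τ(γ) (((M₂−M₁)+1)/γ' + τ(γ')√γ'(1 + log γ')) (1 + 2π|θ|/(M₁+1))`.

No new named facts (D-0026).

## References

* S. Bettin, V. Chandee, Adv. Math. 328 (2018) 1234–1262 (arXiv:1502.00769), Appendix Lemma 1,
  Remark 2, §3 (3.3). [BettinChandee2018]
* W. Duke, J. Friedlander, H. Iwaniec, Invent. Math. 128 (1997) 23–43, Lemma 8.
  [DukeFriedlanderIwaniec1997]
-/

noncomputable section

open Finset Real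

namespace Literature.NumberTheory.LFunctions

/-- **Abel summation against the twist `e(θ/n)`** (generic): if `x₁ ≥ 0` and all partial sums
`∑_{x₁<n≤x₁+k, p n} g(n)` (`k ≤ K`) have norm `≤ B`, then
`‖∑_{x₁<n≤x₁+K, p n} g(n) e(θ/n)‖ ≤ B (1 + 2π|θ|/(x₁+1))`. [folklore] -/
theorem BC_twisted_abel_le (x₁ : ℤ) (hx₁ : 0 ≤ x₁) (K : ℕ) (p : ℤ → Prop) [DecidablePred p]
    (g : ℤ → ℂ) (θ : ℝ) {B : ℝ} (hB : 0 ≤ B)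
    (hpartial : ∀ k : ℕ, k ≤ K → ‖∑ n ∈ (Ioc x₁ (x₁ + k)).filter p, g n‖ ≤ B) :
    ‖∑ n ∈ (Ioc x₁ (x₁ + K)).filter p,
        g n * Complex.exp (2 * Real.pi * Complex.I * ((θ : ℂ) / (n : ℂ)))‖ ≤
      B * (1 + 2 * Real.pi * |θ| / ((x₁ : ℝ) + 1)) := by
  have hx1 : (0 : ℝ) < (x₁ : ℝ) + 1 := by
    have : (0 : ℝ) ≤ x₁ := by exact_mod_cast hx₁
    linarith
  rcases Nat.eq_zero_or_pos K with hK0 | hKpos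
  · subst hK0
    simp only [Nat.cast_zero, add_zero, Finset.Ioc_self, Finset.filter_empty, Finset.sum_empty,
      norm_zero]
    positivity
  have hf1 : ∀ n : ℤ, ‖Complex.exp (2 * Real.pi * Complex.I * ((θ : ℂ) / (n : ℂ)))‖ ≤ 1 := by
    intro n
    have : 2 * (Real.pi : ℂ) * Complex.I * ((θ : ℂ) / (n : ℂ)) =
        ((2 * Real.pi * (θ / n) : ℝ) : ℂ) * Complex.I := by
      push_cast; ring
    rw [this, Complex.norm_exp_ofReal_mul_I]
  have hvar : ∀ n : ℤ, x₁ < n →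
      ‖Complex.exp (2 * Real.pi * Complex.I * ((θ : ℂ) / ((n + 1 : ℤ) : ℂ))) -
        Complex.exp (2 * Real.pi * Complex.I * ((θ : ℂ) / (n : ℂ)))‖ ≤
        2 * Real.pi * |θ| / (n : ℝ) - 2 * Real.pi * |θ| / ((n + 1 : ℤ) : ℝ) := by
    intro n hn
    have hn0 : 0 < n := lt_of_le_of_lt hx₁ hn
    refine (kfw_twist_variation θ hn0).trans (le_of_eq ?_)
    push_cast
    ring
  have h := kfw_abel_bound x₁ hKpos p g
    (fun n : ℤ => Complex.exp (2 * Real.pi * Complex.I * ((θ : ℂ) / (n : ℂ))))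
    (fun n : ℤ => 2 * Real.pi * |θ| / (n : ℝ)) hB hpartial hf1
    (fun n hn => by simpa only [Int.cast_add, Int.cast_one] using hvar n hn)
  refine h.trans (mul_le_mul_of_nonneg_left ?_ hB)
  have hlast : 0 ≤ 2 * Real.pi * |θ| / (((x₁ + (K : ℕ) : ℤ)) : ℝ) := by
    have : (0 : ℝ) < ((x₁ + (K : ℕ) : ℤ) : ℝ) := by
      push_cast
      have : (0 : ℝ) ≤ x₁ := by exact_mod_cast hx₁
      have : (1 : ℝ) ≤ K := by exact_mod_cast hKpos
      linarith
    positivity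
  have e1 : (((x₁ + 1 : ℤ)) : ℝ) = (x₁ : ℝ) + 1 := by push_cast; ring
  rw [e1]
  linarith

/-- **Reducing the Kloosterman-fraction phase by `g = (α, γ)`**: for `γ ≥ 1`, `(x, γ) = 1`,
`e(α x̄^{(γ)}/γ) = e((α/g) x̄^{(γ/g)}/(γ/g))` (the inverses of `x` modulo `γ` and `γ/g` agree modulo
`γ/g`; Bettin–Chandee, proof of Lemma 1: "we can assume … that `(α, γ) = 1`").
[cite: BettinChandee2018, Appendix, proof of Lemma 1] -/
theorem BC_kphase_gcd_reduce {γ : ℕ} (hγ : 0 < γ) (α : ℤ) {x : ℤ} (hx : Int.gcd x γ = 1) :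
    Complex.exp (2 * Real.pi * Complex.I *
        ((α : ℂ) * ((((x : ZMod γ)⁻¹).val : ℕ) : ℂ) / (γ : ℂ))) =
      Complex.exp (2 * Real.pi * Complex.I *
        (((α / (Int.gcd α γ : ℕ) : ℤ) : ℂ) *
          ((((x : ZMod (γ / Int.gcd α γ))⁻¹).val : ℕ) : ℂ) / ((γ / Int.gcd α γ : ℕ) : ℂ))) := by
  set g : ℕ := Int.gcd α γ with hg
  have hg0 : 0 < g := by
    rw [hg]; exact Int.gcd_pos_of_ne_zero_right _ (by exact_mod_cast hγ.ne')
  have hgγ : g ∣ γ := by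
    have := Int.gcd_dvd_right α γ
    rw [← hg] at this
    exact_mod_cast this
  have hgα : (g : ℤ) ∣ α := by
    have := Int.gcd_dvd_left α γ
    rwa [← hg] at this
  obtain ⟨γ', hγ'⟩ := hgγ
  obtain ⟨α', hα'⟩ := hgα
  have hγ'0 : 0 < γ' := Nat.pos_of_ne_zero (by rintro rfl; rw [mul_zero] at hγ'; omega)
  have hdiv1 : γ / g = γ' := by rw [hγ', Nat.mul_div_cancel_left _ hg0]
  have hdiv2 : α / (g : ℤ) = α' := by
    rw [hα', Int.mul_ediv_cancel_left _ (by exact_mod_cast hg0.ne')]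
  rw [hdiv1, hdiv2]
  haveI : NeZero γ := ⟨hγ.ne'⟩
  haveI : NeZero γ' := ⟨hγ'0.ne'⟩
  have hunit : IsUnit (x : ZMod γ) :=
    (ZMod.coe_int_isUnit_iff_isCoprime x γ).mpr
      (Int.isCoprime_iff_gcd_eq_one.mpr (by rwa [Int.gcd_comm]))
  have hd : γ' ∣ γ := ⟨g, by rw [hγ', mul_comm]⟩
  have hmod : ((x : ZMod γ)⁻¹).val % γ' = ((x : ZMod γ')⁻¹).val := KI_inv_val_mod_int hd hunit
  -- rewrite `α/γ = α'/γ'` and reduce the inverse modulo `γ'`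
  set u : ℕ := ((x : ZMod γ)⁻¹).val with hu
  have hγC : (γ : ℂ) = (g : ℂ) * (γ' : ℂ) := by exact_mod_cast hγ'
  have hαC : (α : ℂ) = (g : ℂ) * (α' : ℂ) := by exact_mod_cast hα'
  have hgC : (g : ℂ) ≠ 0 := by exact_mod_cast hg0.ne'
  have hγ'C : (γ' : ℂ) ≠ 0 := by exact_mod_cast hγ'0.ne'
  have e1 : (α : ℂ) * (u : ℂ) / (γ : ℂ) = (α' : ℂ) * (u : ℂ) / (γ' : ℂ) := by
    rw [hγC, hαC]; field_simp
  rw [e1, KI_e_mod α' hγ'0 u, hmod]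

/-- **The sharp incomplete Kloosterman bound** (Bettin–Chandee, Appendix Lemma 1 (kseq), `k = 1`):
for `γ ≥ 1`, `α ∈ ℤ`, `g = (α, γ)`, `γ' = γ/g` and integers `M₁ ≤ M₂`,
`‖∑_{M₁<x≤M₂,(x,γ)=1} e(α x̄/γ)‖ ≤ τ(γ) (((M₂−M₁)+1)/γ' + τ(γ')√γ'(1+log γ'))`
(i.e. `≪ γ^ε((γ/(α,γ))^{1/2} + X(α,γ)/γ)`). [cite: BettinChandee2018, Appendix Lemma 1] -/
theorem BC_msum_sharp_le {γ : ℕ} (hγ : 0 < γ) (α : ℤ) {M₁ M₂ : ℤ} (hM : M₁ ≤ M₂) :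
    ‖∑ x ∈ (Finset.Ioc M₁ M₂).filter (fun x : ℤ => Int.gcd x γ = 1),
        Complex.exp (2 * Real.pi * Complex.I *
          ((α : ℂ) * ((((x : ZMod γ)⁻¹).val : ℕ) : ℂ) / (γ : ℂ)))‖ ≤
      (Nat.divisors γ).card *
        ((((M₂ - M₁ : ℤ) : ℝ) + 1) / ((γ / Int.gcd α γ : ℕ) : ℝ) +
          (Nat.divisors (γ / Int.gcd α γ)).card * Real.sqrt ((γ / Int.gcd α γ : ℕ) : ℝ) *
            (1 + Real.log ((γ / Int.gcd α γ : ℕ) : ℝ))) := by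
  set g : ℕ := Int.gcd α γ with hg
  have hg0 : 0 < g := by
    rw [hg]; exact Int.gcd_pos_of_ne_zero_right _ (by exact_mod_cast hγ.ne')
  have hgγ : g ∣ γ := by
    have := Int.gcd_dvd_right α γ
    rw [← hg] at this
    exact_mod_cast this
  set γ' : ℕ := γ / g with hγ'
  have hγ'0 : 0 < γ' := Nat.div_pos (Nat.le_of_dvd hγ hgγ) hg0
  have hγeq : γ = g * γ' := (Nat.mul_div_cancel' hgγ).symm
  -- rewrite every summand by `BC_kphase_gcd_reduce`, and the filter as `(x,γ')=1 ∧ (x,γ)=1`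
  have hsum : ∑ x ∈ (Finset.Ioc M₁ M₂).filter (fun x : ℤ => Int.gcd x γ = 1),
        Complex.exp (2 * Real.pi * Complex.I *
          ((α : ℂ) * ((((x : ZMod γ)⁻¹).val : ℕ) : ℂ) / (γ : ℂ))) =
      ∑ x ∈ (Finset.Ioc M₁ M₂).filter
          (fun x : ℤ => Int.gcd (0 + 1 * x) γ' = 1 ∧ Int.gcd (0 + 1 * x) γ = 1),
        Complex.exp (2 * Real.pi * Complex.I *
          (((α / (g : ℕ) : ℤ) : ℂ) * (((((0 + 1 * x : ℤ) : ZMod γ')⁻¹).val : ℕ) : ℂ) / (γ' : ℂ))) := by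
    have hfilter : (Finset.Ioc M₁ M₂).filter (fun x : ℤ => Int.gcd x γ = 1) =
        (Finset.Ioc M₁ M₂).filter
          (fun x : ℤ => Int.gcd (0 + 1 * x) γ' = 1 ∧ Int.gcd (0 + 1 * x) γ = 1) := by
      refine Finset.filter_congr fun x _ => ?_
      simp only [zero_add, one_mul]
      constructor
      · intro h
        refine ⟨?_, h⟩
        -- `(x, γ') ∣ (x, γ) = 1`
        have hd : Int.gcd x γ' ∣ Int.gcd x γ := by
          apply Int.dvd_gcd (Int.gcd_dvd_left _ _)
          exact (Int.gcd_dvd_right x γ').trans (by rw [hγeq]; push_cast; exact dvd_mul_left _ _)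
        rw [h] at hd
        exact Nat.dvd_one.mp hd
      · exact fun h => h.2
    rw [hfilter]
    refine Finset.sum_congr rfl fun x hx => ?_
    have hx' := (Finset.mem_filter.mp hx).2.2
    simp only [zero_add, one_mul] at hx' ⊢
    rw [BC_kphase_gcd_reduce hγ α hx']
  rw [hsum]
  have h := KI_sum_progression_coprime_le hγ'0 (q := 1) (Nat.coprime_one_left γ') hγ
    (Nat.coprime_one_right γ) (α / (g : ℕ)) 0 M₁ M₂ hM
  refine h.trans (le_of_eq ?_)
  -- `(α/g, γ') = 1`
  have hcop : Int.gcd (α / (g : ℕ)) γ' = 1 := by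
    have hpos : 0 < Int.gcd α (γ : ℤ) := Int.gcd_pos_of_ne_zero_right _ (by exact_mod_cast hγ.ne')
    have h1 := Int.gcd_div_gcd_div_gcd hpos
    rw [← hg] at h1
    have e2 : ((γ : ℤ) / (g : ℤ)) = ((γ' : ℕ) : ℤ) := by
      rw [hγeq]; push_cast
      exact Int.mul_ediv_cancel_left _ (by exact_mod_cast hg0.ne')
    rw [e2] at h1
    exact h1
  rw [hcop]
  simp only [Nat.cast_one, mul_one, Real.sqrt_one]

/-- **The sharp incomplete Kloosterman bound with the twist `e(θ/x)`** (Bettin–Chandee, Appendix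
Lemma 1 + Remark 2): for `γ ≥ 1`, `α ∈ ℤ`, `g = (α,γ)`, `γ' = γ/g`, integers `0 ≤ M₁ ≤ M₂` and
real `θ`,
`‖∑_{M₁<x≤M₂,(x,γ)=1} e(α x̄/γ) e(θ/x)‖ ≤ τ(γ)(((M₂−M₁)+1)/γ' + τ(γ')√γ'(1+log γ'))(1 + 2π|θ|/(M₁+1))`.
[cite: BettinChandee2018, Appendix Lemma 1 and Remark 2] -/
theorem BC_twisted_msum_sharp_le {γ : ℕ} (hγ : 0 < γ) (α : ℤ) (θ : ℝ) {M₁ M₂ : ℤ}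
    (hM₁ : 0 ≤ M₁) (hM : M₁ ≤ M₂) :
    ‖∑ x ∈ (Finset.Ioc M₁ M₂).filter (fun x : ℤ => Int.gcd x γ = 1),
        Complex.exp (2 * Real.pi * Complex.I *
          ((α : ℂ) * ((((x : ZMod γ)⁻¹).val : ℕ) : ℂ) / (γ : ℂ))) *
        Complex.exp (2 * Real.pi * Complex.I * ((θ : ℂ) / (x : ℂ)))‖ ≤
      (Nat.divisors γ).card *
        ((((M₂ - M₁ : ℤ) : ℝ) + 1) / ((γ / Int.gcd α γ : ℕ) : ℝ) +
          (Nat.divisors (γ / Int.gcd α γ)).card * Real.sqrt ((γ / Int.gcd α γ : ℕ) : ℝ) *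
            (1 + Real.log ((γ / Int.gcd α γ : ℕ) : ℝ))) *
        (1 + 2 * Real.pi * |θ| / ((M₁ : ℝ) + 1)) := by
  obtain ⟨K, hK⟩ : ∃ K : ℕ, M₂ = M₁ + K := ⟨(M₂ - M₁).toNat, by omega⟩
  subst hK
  obtain ⟨γ', hγ'⟩ : ∃ γ' : ℕ, γ' = γ / Int.gcd α γ := ⟨_, rfl⟩
  rw [← hγ']
  have hg0 : 0 < Int.gcd α γ := Int.gcd_pos_of_ne_zero_right _ (by exact_mod_cast hγ.ne')
  have hgγ : Int.gcd α γ ∣ γ := by exact_mod_cast Int.gcd_dvd_right α γ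
  have hγ'0 : 0 < γ' := by rw [hγ']; exact Nat.div_pos (Nat.le_of_dvd hγ hgγ) hg0
  have hlog : 0 ≤ 1 + Real.log (γ' : ℝ) := by
    have := Real.log_nonneg (show (1 : ℝ) ≤ γ' by exact_mod_cast hγ'0); linarith
  have hlen : (0 : ℝ) ≤ ((M₁ + K - M₁ : ℤ) : ℝ) := by
    push_cast; linarith [(Nat.cast_nonneg K : (0:ℝ) ≤ K)]
  have hB0 : 0 ≤ (Nat.divisors γ).card *
      ((((M₁ + K - M₁ : ℤ) : ℝ) + 1) / (γ' : ℝ) +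
        (Nat.divisors γ').card * Real.sqrt (γ' : ℝ) * (1 + Real.log (γ' : ℝ))) := by positivity
  refine BC_twisted_abel_le M₁ hM₁ K (fun x : ℤ => Int.gcd x γ = 1) _ θ hB0 ?_
  intro k hk
  have h := BC_msum_sharp_le hγ α (M₁ := M₁) (M₂ := M₁ + k) (by omega)
  rw [← hγ'] at h
  refine h.trans ?_
  have hk' : (((M₁ + k - M₁ : ℤ)) : ℝ) ≤ ((M₁ + K - M₁ : ℤ) : ℝ) := by
    have : (k : ℝ) ≤ K := by exact_mod_cast hk
    push_cast; linarith
  have hlenk : (0 : ℝ) ≤ ((M₁ + k - M₁ : ℤ) : ℝ) := by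
    push_cast; linarith [(Nat.cast_nonneg k : (0:ℝ) ≤ k)]
  gcongr

end Literature.NumberTheory.LFunctions

end
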